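import Summits.CriticalPhenomena.CardyFormulaZ2.Theorems.CardyComplexConeSLESixFamiliesGiveCardySmoothMarkFamiliesPart10
import HarnessLib

/-!
# STATEMENT F `SmoothMarkFamilies`: admissible discretisation families at smooth exterior marks

Closing helper file for stub `stub_smoothMarkFamilies` of line `collar-touch-sandwich` of crux
`SLESixFamiliesGiveCardy` (stmt-CriticalPhenomena-9654): a Dobrushin domain both of whose marked
points are smooth marks (`IsSmoothMark`: near the mark and after a lattice rotation the domain is
the strict epigraph of a `C²` function in general position or exactly affine along a lattice
direction) carries a square-lattice discretisation family (`ZdDiscretisationFamily`).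

Proof (parts 1–10 + the landed reduction `zdDiscretisationFamily_of_labelling` of
`Theorems/CardySelfRefinementLagHandOffDiscretisableLabelling.lean`): normalise both marks to
monotone `1`-Lipschitz epigraphs in lattice frames (part 7), identify the two arcs near each mark
with the two half-graphs (part 5), and LABEL the square-lattice discrete boundary at every small
mesh: by the frame COLUMN within `6δ` of a mark, by the Voronoi comparison of the two arcs
elsewhere.  The staircase analysis of parts 2–3 gives exactly one crossing edge per mark (the cut
edge between the columns `⌊α/δ⌋` and `⌊α/δ⌋ + 1`), bordering exactly one inner face; the first-order
obstruction of part 4 and the arc gap give "no forcing" (parts 6, 9); the reduction then produces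
marker sets realising the labels, Hausdorff-convergent to the arcs.
-/

noncomputable section

open Set Metric Filter Topology
open Literature.Probability Literature.Probability.RandomPlanarGeometry
  Literature.Probability.LatticeModels Literature.Probability.Percolation
open Summit.CriticalPhenomena.CardyFormulaZ2.Cruxes.LagHandOff.CrosscutDictionary
  (zdDiscretisationFamily_of_labelling exists_pos_le_infDist_arc')

namespace Summit.CriticalPhenomena.CardyFormulaZ2.Cruxes.SLESixFamiliesGiveCardy.CollarTouchSandwich

namespace SmoothMark

/-- Squeeze: an `ℝ≥0∞`-valued function eventually bounded by `ofReal (K δ)` tends to `0` as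
`δ → 0⁺`. [folklore] -/
theorem tendsto_zero_of_eventually_le {f : ℝ → ENNReal} {K : ℝ}
    (h : ∀ᶠ δ in 𝓝[>] (0 : ℝ), f δ ≤ ENNReal.ofReal (K * δ)) : Tendsto f (𝓝[>] 0) (𝓝 0) := by
  have hg : Tendsto (fun δ : ℝ => ENNReal.ofReal (K * δ)) (𝓝[>] 0) (𝓝 0) := by
    have h1 : Tendsto (fun δ : ℝ => K * δ) (𝓝 0) (𝓝 0) := by
      simpa using (tendsto_const_nhds (x := K)).mul (Filter.tendsto_id (x := 𝓝 (0 : ℝ)))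
    have h2 := ENNReal.tendsto_ofReal (tendsto_nhdsWithin_of_tendsto_nhds (s := Ioi 0) h1)
    rwa [ENNReal.ofReal_zero] at h2
  exact tendsto_of_tendsto_of_tendsto_of_le_of_le' tendsto_const_nhds hg (Eventually.of_forall fun _ => zero_le) h

/-- **Discretisation families at smooth marks.** A Dobrushin domain both of whose marked points are
smooth marks carries a `ZdDiscretisationFamily`. [folklore] -/
theorem exists_zdDiscretisationFamily_of_isSmoothMark (D : DobrushinDomain) (h0 : IsSmoothMark D 0)
    (h1 : IsSmoothMark D 1) : ∃ Λ : ℝ → DiscreteDobrushin, ZdDiscretisationFamily D Λ := by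
  classical
  obtain ⟨k₀, s₀, t₀, U₀, V₀, G₀, α₀, R₀, hs₀, ht₀, hU₀, hV₀, hp₀, hR₀, hmono₀, hlip₀, hepi₀, hdiff₀⟩ :=
    exists_frame_of_isSmoothMark D 0 h0
  obtain ⟨k₁, s₁, t₁, U₁, V₁, G₁, α₁, R₁, hs₁, ht₁, hU₁, hV₁, hp₁, hR₁, hmono₁, hlip₁, hepi₁, hdiff₁⟩ :=
    exists_frame_of_isSmoothMark D 1 h1
  -- a common radius, below the distance of the two marks
  have hd01 : 0 < dist (D.pt 0) (D.pt 1) := dist_pos.2 fun h => absurd (D.pt_injective h) (by decide)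
  set R : ℝ := min (min R₀ R₁) (dist (D.pt 0) (D.pt 1)) with hR
  have hRpos : 0 < R := lt_min (lt_min hR₀ hR₁) hd01
  have hRR₀ : R ≤ R₀ := (min_le_left _ _).trans (min_le_left _ _)
  have hRR₁ : R ≤ R₁ := (min_le_left _ _).trans (min_le_right _ _)
  have hR01 : R ≤ dist (D.pt 0) (D.pt 1) := min_le_right _ _
  have hfar₀ : R ≤ dist (D.pt (0 + 1)) (D.pt 0) := by rw [zero_add, dist_comm]; exact hR01
  have hfar₁ : R ≤ dist (D.pt (1 + 1)) (D.pt 1) := by rw [show (1 : Fin 2) + 1 = 0 from rfl]; exact hR01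
  have hepi₀' : ∀ a b : ℝ, dist ((a : ℂ) * U₀ + (b : ℂ) * V₀) (D.pt 0) < R →
      ((a : ℂ) * U₀ + (b : ℂ) * V₀ ∈ D.carrier ↔ G₀ a < b) := fun a b h => hepi₀ a b (h.trans_le hRR₀)
  have hepi₁' : ∀ a b : ℝ, dist ((a : ℂ) * U₁ + (b : ℂ) * V₁) (D.pt 1) < R →
      ((a : ℂ) * U₁ + (b : ℂ) * V₁ ∈ D.carrier ↔ G₁ a < b) := fun a b h => hepi₁ a b (h.trans_le hRR₁)
  have hdiff₀' : ∀ c, |c - α₀| < R → DifferentiableAt ℝ G₀ c := fun c h => hdiff₀ c (h.trans_le hRR₀)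
  have hdiff₁' : ∀ c, |c - α₁| < R → DifferentiableAt ℝ G₁ c := fun c h => hdiff₁ c (h.trans_le hRR₁)
  obtain ⟨σ₀, hσp₀, hσm₀⟩ :=
    exists_side_arcs D 0 hs₀ ht₀ hU₀ hV₀ hp₀ hmono₀ hlip₀ hepi₀' hfar₀ D.isOpen hRpos
  obtain ⟨σ₁, hσp₁, hσm₁⟩ :=
    exists_side_arcs D 1 hs₁ ht₁ hU₁ hV₁ hp₁ hmono₁ hlip₁ hepi₁' hfar₁ D.isOpen hRpos
  obtain ⟨δ₀, hδ₀, hbulk₀⟩ := eventually_bulk D 0 hs₀ ht₀ hU₀ hV₀ hp₀ hlip₀ hepi₀' hRpos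
  obtain ⟨δ₁, hδ₁, hbulk₁⟩ := eventually_bulk D 1 hs₁ ht₁ hU₁ hV₁ hp₁ hlip₁ hepi₁' hRpos
  obtain ⟨c₀, hc₀, hgap⟩ := exists_pos_le_infDist_arc' D (ρ := R / 32) (by positivity)
  -- the labelling: column tests near the marks, Voronoi comparison elsewhere
  set C : ℝ → Fin 2 → Site 2 → Prop := fun δ =>
    ![fun x => (⌊α₀ / δ⌋ + 1 ≤ s₀ * x k₀ ↔ σ₀ = 0), fun x => (⌊α₁ / δ⌋ + 1 ≤ s₁ * x k₁ ↔ σ₁ = 0)] with hC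
  set A : ℝ → Site 2 → Prop := fun δ x =>
    (dist (meshPoint δ x) (D.pt 0) < 6 * δ ∧ C δ 0 x) ∨
    (¬ dist (meshPoint δ x) (D.pt 0) < 6 * δ ∧ dist (meshPoint δ x) (D.pt 1) < 6 * δ ∧ C δ 1 x) ∨
    (¬ dist (meshPoint δ x) (D.pt 0) < 6 * δ ∧ ¬ dist (meshPoint δ x) (D.pt 1) < 6 * δ ∧
      infDist (meshPoint δ x) (D.arc 0) ≤ infDist (meshPoint δ x) (D.arc 1)) with hA
  -- the cut edges
  set z : ℝ → Fin 2 → Fin 2 → Site 2 := fun δ =>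
    ![![Pi.single k₀ (s₀ * (⌊α₀ / δ⌋ + 1 - 1)) + Pi.single k₀.rev (t₀ * (⌊G₀ (δ * (⌊α₀ / δ⌋ + 1 : ℤ)) / δ⌋ + 1)),
        Pi.single k₀ (s₀ * (⌊α₀ / δ⌋ + 1)) + Pi.single k₀.rev (t₀ * (⌊G₀ (δ * (⌊α₀ / δ⌋ + 1 : ℤ)) / δ⌋ + 1))],
      ![Pi.single k₁ (s₁ * (⌊α₁ / δ⌋ + 1 - 1)) + Pi.single k₁.rev (t₁ * (⌊G₁ (δ * (⌊α₁ / δ⌋ + 1 : ℤ)) / δ⌋ + 1)),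
        Pi.single k₁ (s₁ * (⌊α₁ / δ⌋ + 1)) + Pi.single k₁.rev (t₁ * (⌊G₁ (δ * (⌊α₁ / δ⌋ + 1 : ℤ)) / δ⌋ + 1))]]
    with hz
  -- small meshes
  set δs : ℝ := min (min δ₀ δ₁) (min (R / 128) (c₀ / 16)) with hδs
  have hδspos : 0 < δs := lt_min (lt_min hδ₀ hδ₁) (lt_min (by positivity) (by positivity))
  have hgood : ∀ δ : ℝ, 0 < δ → δ < δs →
      {x | x ∈ (⟨D.carrier, δ, ∅, ∅⟩ : DiscreteDobrushin).zdBoundary ∧ A δ x} ∪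
          {x | x ∈ (⟨D.carrier, δ, ∅, ∅⟩ : DiscreteDobrushin).zdBoundary ∧ ¬ A δ x} =
          (⟨D.carrier, δ, ∅, ∅⟩ : DiscreteDobrushin).zdBoundary ∧
        Disjoint {x | x ∈ (⟨D.carrier, δ, ∅, ∅⟩ : DiscreteDobrushin).zdBoundary ∧ A δ x}
          {x | x ∈ (⟨D.carrier, δ, ∅, ∅⟩ : DiscreteDobrushin).zdBoundary ∧ ¬ A δ x} ∧
        {x | x ∈ (⟨D.carrier, δ, ∅, ∅⟩ : DiscreteDobrushin).zdBoundary ∧ A δ x}.Nonempty ∧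
        {x | x ∈ (⟨D.carrier, δ, ∅, ∅⟩ : DiscreteDobrushin).zdBoundary ∧ ¬ A δ x}.Nonempty ∧
        (∀ y ∈ {x | x ∈ (⟨D.carrier, δ, ∅, ∅⟩ : DiscreteDobrushin).zdBoundary ∧ A δ x},
          ¬ closedBall (meshPoint δ y) (infDist (meshPoint δ y) (frontier D.carrier)) ⊆
            ⋃ x ∈ {x | x ∈ (⟨D.carrier, δ, ∅, ∅⟩ : DiscreteDobrushin).zdBoundary ∧ ¬ A δ x},
              closedBall (meshPoint δ x) (infDist (meshPoint δ x) (frontier D.carrier))) ∧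
        (∀ x ∈ {x | x ∈ (⟨D.carrier, δ, ∅, ∅⟩ : DiscreteDobrushin).zdBoundary ∧ ¬ A δ x},
          ¬ closedBall (meshPoint δ x) (infDist (meshPoint δ x) (frontier D.carrier)) ⊆
            ⋃ y ∈ {x | x ∈ (⟨D.carrier, δ, ∅, ∅⟩ : DiscreteDobrushin).zdBoundary ∧ A δ x},
              closedBall (meshPoint δ y) (infDist (meshPoint δ y) (frontier D.carrier))) ∧
        (∀ y ∈ {x | x ∈ (⟨D.carrier, δ, ∅, ∅⟩ : DiscreteDobrushin).zdBoundary ∧ A δ x},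
          infDist (meshPoint δ y) (D.arc 0) ≤ 6 * δ) ∧
        (∀ x ∈ {x | x ∈ (⟨D.carrier, δ, ∅, ∅⟩ : DiscreteDobrushin).zdBoundary ∧ ¬ A δ x},
          infDist (meshPoint δ x) (D.arc 1) ≤ 6 * δ) ∧
        {e | e ∈ (discreteDomainGraph D.carrier δ).edgeSet ∧
          (∃ x ∈ e, x ∈ {x | x ∈ (⟨D.carrier, δ, ∅, ∅⟩ : DiscreteDobrushin).zdBoundary ∧ A δ x}) ∧
          ∃ y ∈ e, y ∈ {x | x ∈ (⟨D.carrier, δ, ∅, ∅⟩ : DiscreteDobrushin).zdBoundary ∧ ¬ A δ x}}.ncard = 2 ∧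
        (∀ e ∈ (discreteDomainGraph D.carrier δ).edgeSet,
          (∃ x ∈ e, x ∈ {x | x ∈ (⟨D.carrier, δ, ∅, ∅⟩ : DiscreteDobrushin).zdBoundary ∧ A δ x}) →
          (∃ y ∈ e, y ∈ {x | x ∈ (⟨D.carrier, δ, ∅, ∅⟩ : DiscreteDobrushin).zdBoundary ∧ ¬ A δ x}) →
          ∃! f, (⟨D.carrier, δ, ∅, ∅⟩ : DiscreteDobrushin).IsInnerFace f ∧
            ∀ x ∈ e, LatticeModels.IsCorner x f) ∧
        {e | e ∈ (discreteDomainGraph D.carrier δ).edgeSet ∧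
          (∃ x ∈ e, x ∈ {x | x ∈ (⟨D.carrier, δ, ∅, ∅⟩ : DiscreteDobrushin).zdBoundary ∧ A δ x}) ∧
          ∃ y ∈ e, y ∈ {x | x ∈ (⟨D.carrier, δ, ∅, ∅⟩ : DiscreteDobrushin).zdBoundary ∧ ¬ A δ x}} =
          {s(z δ 0 0, z δ 0 1), s(z δ 1 0, z δ 1 1)} ∧
        hausdorffEDist (medialPoint δ '' {s(z δ 0 0, z δ 0 1), s(z δ 1 0, z δ 1 1)}) {D.pt 0, D.pt 1} ≤
          ENNReal.ofReal (5 * δ) := by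
    intro δ hδ hδlt
    have hδδ₀ : δ < δ₀ := hδlt.trans_le ((min_le_left _ _).trans (min_le_left _ _))
    have hδδ₁ : δ < δ₁ := hδlt.trans_le ((min_le_left _ _).trans (min_le_right _ _))
    have hδR : 128 * δ ≤ R := by
      have := hδlt.trans_le ((min_le_right _ _).trans (min_le_left _ _)); linarith
    have hc : 8 * δ < c₀ := by
      have := hδlt.trans_le ((min_le_right _ _).trans (min_le_right _ _)); linarith
    -- the label near each mark and far from both
    have hnear0 : ∀ x, dist (meshPoint δ x) (D.pt 0) < 6 * δ → (A δ x ↔ C δ 0 x) := by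
      intro x hx; simp only [hA, hx, true_and, not_true_eq_false, false_and, or_false]
    have hnear1 : ∀ x, dist (meshPoint δ x) (D.pt 1) < 6 * δ → (A δ x ↔ C δ 1 x) := by
      intro x hx
      have hx0 : ¬ dist (meshPoint δ x) (D.pt 0) < 6 * δ := by
        intro h
        have := dist_triangle (D.pt 0) (meshPoint δ x) (D.pt 1)
        rw [dist_comm (D.pt 0) (meshPoint δ x)] at this
        linarith
      simp only [hA, hx, hx0, true_and, not_true_eq_false, false_and, or_false, false_or, not_false_eq_true]
    have hvor : ∀ x, 6 * δ ≤ dist (meshPoint δ x) (D.pt 0) → 6 * δ ≤ dist (meshPoint δ x) (D.pt 1) →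
        (A δ x ↔ infDist (meshPoint δ x) (D.arc 0) ≤ infDist (meshPoint δ x) (D.arc 1)) := by
      intro x h0 h1
      simp only [hA, not_lt.2 h0, not_lt.2 h1, false_and, false_or, not_false_eq_true, true_and]
    obtain ⟨hAC₀, hCC₀, hz₀, hzu₀, hzf₀⟩ := perMark_facts D 0 hs₀ ht₀ hU₀ hV₀ hp₀ hmono₀ hlip₀ hepi₀' hdiff₀'
      hσp₀ hσm₀ hfar₀ hδ hδR (hbulk₀ δ hδ hδδ₀) (A δ) hnear0 (fun x h0 h1 => hvor x h0 (by simpa using h1))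
    obtain ⟨hAC₁, hCC₁, hz₁, hzu₁, hzf₁⟩ := perMark_facts D 1 hs₁ ht₁ hU₁ hV₁ hp₁ hmono₁ hlip₁ hepi₁' hdiff₁'
      hσp₁ hσm₁ hfar₁ hδ hδR (hbulk₁ δ hδ hδδ₁) (A δ) hnear1
      (fun x h1 h0 => hvor x (by simpa [show (1 : Fin 2) + 1 = 0 from rfl] using h0) h1)
    refine package_at_mesh D (A δ) (C δ) (z δ) hδ hδR hR01 hgap hc hvor ?_ ?_ ?_ ?_ ?_
    · intro i; fin_cases i; exacts [hAC₀, hAC₁]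
    · intro i; fin_cases i; exacts [hCC₀, hCC₁]
    · intro i; fin_cases i; exacts [hz₀, hz₁]
    · intro i; fin_cases i; exacts [hzu₀, hzu₁]
    · intro i; fin_cases i; exacts [hzf₀, hzf₁]
  -- the reduction
  have hev : ∀ᶠ δ in 𝓝[>] (0 : ℝ), 0 < δ ∧ δ < δs := by
    filter_upwards [Ioo_mem_nhdsGT hδspos] with δ hδ using ⟨hδ.1, hδ.2⟩
  refine zdDiscretisationFamily_of_labelling D
    (fun δ => {x | x ∈ (⟨D.carrier, δ, ∅, ∅⟩ : DiscreteDobrushin).zdBoundary ∧ A δ x})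
    (fun δ => {x | x ∈ (⟨D.carrier, δ, ∅, ∅⟩ : DiscreteDobrushin).zdBoundary ∧ ¬ A δ x})
    (fun δ => 6 * δ) ?_ ?_ ?_
  · have : Tendsto (fun δ : ℝ => 6 * δ) (𝓝 0) (𝓝 0) := by
      simpa using (tendsto_const_nhds (x := (6 : ℝ))).mul (Filter.tendsto_id (x := 𝓝 (0 : ℝ)))
    exact tendsto_nhdsWithin_of_tendsto_nhds this
  · filter_upwards [hev] with δ hδ
    obtain ⟨h1, h2, h3, h4, h5, h6, h7, h8, h9, h10, -, -⟩ := hgood δ hδ.1 hδ.2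
    exact ⟨h1, h2, h3, h4, h5, h6, h7, h8, h9, h10⟩
  · refine tendsto_zero_of_eventually_le (K := 5) ?_
    filter_upwards [hev] with δ hδ
    obtain ⟨-, -, -, -, -, -, -, -, -, -, hcross, hH⟩ := hgood δ hδ.1 hδ.2
    simp only [mem_setOf_eq] at hcross ⊢
    rw [hcross]
    exact hH

end SmoothMark

/-- **STUB `stub_smoothMarkFamilies`** (STATEMENT F `SmoothMarkFamilies` of the line): a Dobrushin
domain both of whose marked points are smooth marks carries a square-lattice discretisation family.
[folklore] -/
theorem stub_smoothMarkFamilies : SmoothMarkFamilies :=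
  fun D h0 h1 => SmoothMark.exists_zdDiscretisationFamily_of_isSmoothMark D h0 h1

end Summit.CriticalPhenomena.CardyFormulaZ2.Cruxes.SLESixFamiliesGiveCardy.CollarTouchSandwich

end
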